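import Summits.HodgeConjecture.HodgeConjecture.Theorems.K2E3SmoothTraceCompositionSeries          -- ★ (JH-Σ) `exists_smoothIrrep_isConstituentOf_smoothTrace_eq_sum`
import Summits.HodgeConjecture.HodgeConjecture.Theorems.F0P3bInducedCharTransferSigned          -- ★ the A1 vocabulary (`IsLocSmooth`, `IsLocalDeltaTransfer`, `finExplicitCollection`) + `Representation.IsAdmissible`∕`IsFiniteLength` currency (as ★ p861751)
import Literature.NumberTheory.Rogawski1990.FinExplicitTransferFactorConjRight                    -- ★ `finExplicitDelta_conj_left_all ∕ _right_all` (Δ‴ of record)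
import Literature.NumberTheory.Automorphic.UnitaryGroupPrincipalSeriesH                          -- ★ `cmPrincipalSeries`, `torusCharPair`, `IsQuadraticCharExtension` closure (T4 currency)
import Literature.NumberTheory.Automorphic.IrreducibleClassesBoxChar                              -- ★ `IrrClass.boxChar`, `IrrClass.boxChar_injective` (T4 `ρ = O ⊠ χ`)
import HarnessLib

/-!
# R90 · S3 — A1 for the l.d.s.-`H` packets (TYPE T4), from print's VIRTUAL-CHARACTER identity [L. 4.9.2 signed; §12.1 case (2); §13.1 Thm. 13.1.1 (2)]

R90-TF section S3 (dealer R90-C12-plan (g0)), hand p09 (RE-DEALT to K2E3-p36 (g2) 16:30:44Z), payer of FILE D's TYPE-SOCKET `stub_R90_S3_endoExpansion_ldsH` at D ED. 3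
through FILE E's print socket 4 `stub_R90_S3_print_492_lds` (E v5 6580cb6ec6af1dbb, RULING S3-R8: the F1′ «virtual» shape).

THE CLAUSE.  Socket A1 (`Lines/R90_S3_EndoCharIdentityA`) asks, at the record local data, for an INTEGER expansion `c` with `Σ_{σ∈ρ} Tr σ(f^H) = Σ_π c(π) Tr π(f)` on
`Δ‴_v`-matched test pairs (file C's `IsEndoExpansion`, here UNFOLDED).  TYPE T4 «lds-H» (D :211, print's type (6), §12.1 p. 171 case (2)): `ρ = O ⊠ χ` where `O` is the set
of constituents of the reducible unitary principal series `i(χ₁, χ₂)` of `U(Φ₂)_v` with `χ₁|_{F^×} = ω_{E/F}` (`hL`, D's premise BYTE FOR BYTE).  PRINT INPUT (`hINDv`, E's socket-4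
conclusion BYTE FOR BYTE): for such `ρ` there are an integer `ε` and an admissible finite-length representation `I` of `G′_v` with `Σ_{σ∈ρ} Tr σ(f^H) = ε · Tr I(f)` on
`Δ‴_v`-matched test pairs — print: Lemma 4.9.2 (signed at `Δ‴_v`) gives `Tr i_H(χ)(f^H) = ε_v · Tr i_G(χ̃)(f)`, and `Tr i_H(χ) = Σ_{σ∈O} Tr σ ⊗ χ` by additivity of the
trace over the (multiplicity-free, length-two or irreducible) Jordan–Hölder series [§11.1 Prop. 11.1.1 (c); §12.2 pp. 172–173].

THE PROOF (bookkeeping, ★ p861751's machinery): `hL` supplies the telescope `(O, χ, hχ, χ₁, χ₂)`; `hINDv` at it gives `(ε, I)`; ★ (JH-Σ)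
`exists_smoothIrrep_isConstituentOf_smoothTrace_eq_sum` expands `Tr I(f) = Σ_i Tr ⟦r_i⟧(f)` over the composition factors of `I`; `c := Σ_i single ⟦r_i⟧ ε ∈ ℤ[Irr G′_v]`
(coefficient of a class = `ε ×` its multiplicity in `I`).  NAME-SHAPE: conclusion = A1's body UNFOLDED token for token (tree A :88–:95; Theorems may not import `Lines`);
the record side conditions `hH′ hH′d hμu hμω hv hm hT` and `hρ : IsRogPacketH L v ρ` are not used and are therefore not binders.  D ED. 3 pays T4 by
`exact endoExpansion_exists_of_ldsH_virtual L H′ v μ νG νH mH mG ρ hL (stub_R90_S3_print_492_lds L H′ v hH′ hH′d μ hμu hμω hv νG νH mH mG hm hT ρ hρ)`.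
HONEST LABEL: proves the T4 clause CONDITIONALLY on the printed virtual-character identity (E socket 4); HC_CM is proved only modulo the 7 printed citations (2 remaining
named inputs: hLiu418 = stmt-HodgeConjecture-24832, h413 = stmt-HodgeConjecture-24833) until rung 0 closes; count-neutral; REL ≠ ★ ≠ BUILT.
-/

set_option autoImplicit false
set_option linter.dupNamespace false

noncomputable section

namespace Summit.HodgeConjecture.HodgeConjecture.R90.S3

open MeasureTheory IsDedekindDomain NumberField
open Literature.NumberTheory Literature.NumberTheory.Automorphic Literature.NumberTheory.Automorphic.UnitaryGroup
open Literature.NumberTheory.Rogawski1990 Literature.NumberTheory.GaloisRepresentations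
open Summit.HodgeConjecture.HodgeConjecture.Cruxes.H413.K2E3SmoothTraceCompositionSeries (exists_smoothIrrep_isConstituentOf_smoothTrace_eq_sum)
open scoped Matrix

variable (L : Type) [Field L] [NumberField L] [IsCMField L] (H' : Matrix (Fin 3) (Fin 3) L)
  (v : HeightOneSpectrum (𝓞 ↥(maximalRealSubfield L)))

/-- **A1 for the l.d.s.-`H` packets (T4) from the printed virtual-character identity** [§12.1 case (2) p. 171; Lemma 4.9.2 p. 56; Thm. 13.1.1 (2) p. 198]: at the
record local data of socket A1, for a finite set `ρ = O ⊠ χ` of classes of `H_v` with `O` the constituents of `i(χ₁, χ₂)`, `χ₁|_{F^×} = ω_{E/F}` (`hL`, D's T4 premise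
verbatim), GIVEN print's identity `Σ_{σ∈ρ} Tr σ(f^H) = ε · Tr I(f)` on `Δ‴_v`-matched test pairs for an integer `ε` and an admissible finite-length `I` (`hINDv`, E's
socket 4 verbatim), there is an integer expansion `c = Σ_i ε·⟦r_i⟧` over the composition factors of `I` with `Σ_{σ∈ρ} Tr σ(f^H) = Σ_π c(π) Tr π(f)` on every
`Δ‴_v`-matched pair of test functions (A1's conclusion, unfolded). [cite: Rogawski1990, §12.1 p. 171; §4.9 Lemma 4.9.2 pp. 55–56; §13.1 Thm. 13.1.1 (2) p. 198] [cite: BernsteinZelevinsky1977, §2.3] -/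
theorem endoExpansion_exists_of_ldsH_virtual
    (μ : HeckeCharacter L)
    [MeasurableSpace ((UnitaryGroup.cmDatum L 3 H').Local v)] [BorelSpace ((UnitaryGroup.cmDatum L 3 H').Local v)]
    [MeasurableSpace ((UnitaryGroup.cmDatum L 2 (Matrix.of fun i j : Fin 2 => if i.val + j.val + 1 = 2 then (1 : L) else 0)).Local v ×
      (UnitaryGroup.cmDatum L 1 (Matrix.of fun i j : Fin 1 => if i.val + j.val + 1 = 1 then (1 : L) else 0)).Local v)]
    [BorelSpace ((UnitaryGroup.cmDatum L 2 (Matrix.of fun i j : Fin 2 => if i.val + j.val + 1 = 2 then (1 : L) else 0)).Local v ×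
      (UnitaryGroup.cmDatum L 1 (Matrix.of fun i j : Fin 1 => if i.val + j.val + 1 = 1 then (1 : L) else 0)).Local v)]
    [∀ a : ((UnitaryGroup.cmDatum L 2 (Matrix.of fun i j : Fin 2 => if i.val + j.val + 1 = 2 then (1 : L) else 0)).Local v ×
      (UnitaryGroup.cmDatum L 1 (Matrix.of fun i j : Fin 1 => if i.val + j.val + 1 = 1 then (1 : L) else 0)).Local v),
      MeasurableSpace (((UnitaryGroup.cmDatum L 2 (Matrix.of fun i j : Fin 2 => if i.val + j.val + 1 = 2 then (1 : L) else 0)).Local v ×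
      (UnitaryGroup.cmDatum L 1 (Matrix.of fun i j : Fin 1 => if i.val + j.val + 1 = 1 then (1 : L) else 0)).Local v) ⧸
        Subgroup.centralizer ({a} : Set ((UnitaryGroup.cmDatum L 2 (Matrix.of fun i j : Fin 2 => if i.val + j.val + 1 = 2 then (1 : L) else 0)).Local v ×
      (UnitaryGroup.cmDatum L 1 (Matrix.of fun i j : Fin 1 => if i.val + j.val + 1 = 1 then (1 : L) else 0)).Local v)))]
    [∀ a : ((UnitaryGroup.cmDatum L 2 (Matrix.of fun i j : Fin 2 => if i.val + j.val + 1 = 2 then (1 : L) else 0)).Local v ×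
      (UnitaryGroup.cmDatum L 1 (Matrix.of fun i j : Fin 1 => if i.val + j.val + 1 = 1 then (1 : L) else 0)).Local v),
      BorelSpace (((UnitaryGroup.cmDatum L 2 (Matrix.of fun i j : Fin 2 => if i.val + j.val + 1 = 2 then (1 : L) else 0)).Local v ×
      (UnitaryGroup.cmDatum L 1 (Matrix.of fun i j : Fin 1 => if i.val + j.val + 1 = 1 then (1 : L) else 0)).Local v) ⧸
        Subgroup.centralizer ({a} : Set ((UnitaryGroup.cmDatum L 2 (Matrix.of fun i j : Fin 2 => if i.val + j.val + 1 = 2 then (1 : L) else 0)).Local v ×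
      (UnitaryGroup.cmDatum L 1 (Matrix.of fun i j : Fin 1 => if i.val + j.val + 1 = 1 then (1 : L) else 0)).Local v)))]
    [∀ γ : ((UnitaryGroup.cmDatum L 3 H').Local v), MeasurableSpace (((UnitaryGroup.cmDatum L 3 H').Local v) ⧸ Subgroup.centralizer ({γ} : Set ((UnitaryGroup.cmDatum L 3 H').Local v)))]
    [∀ γ : ((UnitaryGroup.cmDatum L 3 H').Local v), BorelSpace (((UnitaryGroup.cmDatum L 3 H').Local v) ⧸ Subgroup.centralizer ({γ} : Set ((UnitaryGroup.cmDatum L 3 H').Local v)))]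
    (νG : Measure ((UnitaryGroup.cmDatum L 3 H').Local v)) [νG.IsHaarMeasure] [νG.IsMulRightInvariant]
    (νH : Measure ((UnitaryGroup.cmDatum L 2 (Matrix.of fun i j : Fin 2 => if i.val + j.val + 1 = 2 then (1 : L) else 0)).Local v ×
      (UnitaryGroup.cmDatum L 1 (Matrix.of fun i j : Fin 1 => if i.val + j.val + 1 = 1 then (1 : L) else 0)).Local v))
    [νH.IsHaarMeasure] [νH.IsMulRightInvariant]
    (mH : OrbitalMeasureFamily ((UnitaryGroup.cmDatum L 2 (Matrix.of fun i j : Fin 2 => if i.val + j.val + 1 = 2 then (1 : L) else 0)).Local v ×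
      (UnitaryGroup.cmDatum L 1 (Matrix.of fun i j : Fin 1 => if i.val + j.val + 1 = 1 then (1 : L) else 0)).Local v))
    (mG : OrbitalMeasureFamily ((UnitaryGroup.cmDatum L 3 H').Local v))
    (ρ : Finset (IrrClass ((UnitaryGroup.cmDatum L 2 (Matrix.of fun i j : Fin 2 => if i.val + j.val + 1 = 2 then (1 : L) else 0)).Local v ×
      (UnitaryGroup.cmDatum L 1 (Matrix.of fun i j : Fin 1 => if i.val + j.val + 1 = 1 then (1 : L) else 0)).Local v)))
    (hL : ∃ (O : Finset (IrrClass ((UnitaryGroup.cmDatum L 2 (Matrix.of fun i j : Fin 2 => if i.val + j.val + 1 = 2 then (1 : L) else 0)).Local v)))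
        (χ : (UnitaryGroup.cmDatum L 1 (Matrix.of fun i j : Fin 1 => if i.val + j.val + 1 = 1 then (1 : L) else 0)).Local v →* ℂˣ)
        (hχ : IsOpen ((χ.ker : Subgroup ((UnitaryGroup.cmDatum L 1 (Matrix.of fun i j : Fin 1 => if i.val + j.val + 1 = 1 then (1 : L) else 0)).Local v)) :
          Set ((UnitaryGroup.cmDatum L 1 (Matrix.of fun i j : Fin 1 => if i.val + j.val + 1 = 1 then (1 : L) else 0)).Local v)))
        (χ₁ : (UnitaryGroup.LocalRing L v)ˣ →* ℂˣ) (χ₂ : ↥(normOneUnits (conjLocal L (IsCMField.complexConj L) v)) →* ℂˣ),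
        IsQuadraticCharExtension (conjLocal L (IsCMField.complexConj L) v) χ₁ ∧
        (∀ c : IrrClass ((UnitaryGroup.cmDatum L 2 (Matrix.of fun i j : Fin 2 => if i.val + j.val + 1 = 2 then (1 : L) else 0)).Local v), c ∈ O ↔
          c.IsConstituentOf
            (cmPrincipalSeries L 2 v
              (torusCharPair (conjLocal L (IsCMField.complexConj L) v) (cmLocalForm L 2 v) (cmLocalForm_eq_over L 2 v) 0 χ₁ χ₂))) ∧
        ρ = O.map ⟨IrrClass.boxChar χ hχ, IrrClass.boxChar_injective χ hχ⟩)
    (hINDv : ∀ (O : Finset (IrrClass ((UnitaryGroup.cmDatum L 2 (Matrix.of fun i j : Fin 2 => if i.val + j.val + 1 = 2 then (1 : L) else 0)).Local v)))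
        (χ : (UnitaryGroup.cmDatum L 1 (Matrix.of fun i j : Fin 1 => if i.val + j.val + 1 = 1 then (1 : L) else 0)).Local v →* ℂˣ)
        (hχ : IsOpen ((χ.ker : Subgroup ((UnitaryGroup.cmDatum L 1 (Matrix.of fun i j : Fin 1 => if i.val + j.val + 1 = 1 then (1 : L) else 0)).Local v)) :
          Set ((UnitaryGroup.cmDatum L 1 (Matrix.of fun i j : Fin 1 => if i.val + j.val + 1 = 1 then (1 : L) else 0)).Local v)))
        (χ₁ : (UnitaryGroup.LocalRing L v)ˣ →* ℂˣ) (χ₂ : ↥(normOneUnits (conjLocal L (IsCMField.complexConj L) v)) →* ℂˣ),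
        IsQuadraticCharExtension (conjLocal L (IsCMField.complexConj L) v) χ₁ →
        (∀ c : IrrClass ((UnitaryGroup.cmDatum L 2 (Matrix.of fun i j : Fin 2 => if i.val + j.val + 1 = 2 then (1 : L) else 0)).Local v), c ∈ O ↔
          c.IsConstituentOf
            (cmPrincipalSeries L 2 v
              (torusCharPair (conjLocal L (IsCMField.complexConj L) v) (cmLocalForm L 2 v) (cmLocalForm_eq_over L 2 v) 0 χ₁ χ₂))) →
        ρ = O.map ⟨IrrClass.boxChar χ hχ, IrrClass.boxChar_injective χ hχ⟩ →
          ∃ (ε : ℤ) (W : Type) (_ : AddCommGroup W) (_ : Module ℂ W) (I : Representation ℂ ((UnitaryGroup.cmDatum L 3 H').Local v) W),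
            I.IsAdmissible ∧ IsFiniteLength (MonoidAlgebra ℂ ((UnitaryGroup.cmDatum L 3 H').Local v)) I.asModule ∧
            ∀ (fH : (UnitaryGroup.cmDatum L 2 (Matrix.of fun i j : Fin 2 => if i.val + j.val + 1 = 2 then (1 : L) else 0)).Local v ×
                (UnitaryGroup.cmDatum L 1 (Matrix.of fun i j : Fin 1 => if i.val + j.val + 1 = 1 then (1 : L) else 0)).Local v → ℂ)
              (f : (UnitaryGroup.cmDatum L 3 H').Local v → ℂ),
              IsLocSmooth fH → IsLocSmooth f →
                IsLocalDeltaTransfer L H' v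
                  (finExplicitCollection L H' μ (finExplicitDelta_conj_left_all L H' μ) (finExplicitDelta_conj_right_all L H' μ) v) mH mG fH f →
                ∑ σ ∈ ρ, σ.smoothTrace νH fH = (ε : ℂ) * I.smoothTrace νG f) :
    ∃ c : IrrClass ((UnitaryGroup.cmDatum L 3 H').Local v) →₀ ℤ,
      ∀ (fH : (UnitaryGroup.cmDatum L 2 (Matrix.of fun i j : Fin 2 => if i.val + j.val + 1 = 2 then (1 : L) else 0)).Local v ×
        (UnitaryGroup.cmDatum L 1 (Matrix.of fun i j : Fin 1 => if i.val + j.val + 1 = 1 then (1 : L) else 0)).Local v → ℂ)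
        (f : (UnitaryGroup.cmDatum L 3 H').Local v → ℂ),
        IsLocSmooth fH → IsLocSmooth f →
          IsLocalDeltaTransfer L H' v
            (finExplicitCollection L H' μ (finExplicitDelta_conj_left_all L H' μ) (finExplicitDelta_conj_right_all L H' μ) v) mH mG fH f →
          ∑ σ ∈ ρ, σ.smoothTrace νH fH = ∑ π ∈ c.support, (c π : ℂ) * π.smoothTrace νG f := by
  classical
  -- bookkeeping for `Finsupp.sum` against `π ↦ n ↦ (n : ℂ) * Tr π(f)`
  have h0 : ∀ (f : (UnitaryGroup.cmDatum L 3 H').Local v → ℂ) (π : IrrClass ((UnitaryGroup.cmDatum L 3 H').Local v)),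
      (((0 : ℤ) : ℤ) : ℂ) * π.smoothTrace νG f = 0 := fun f π => by simp
  have hadd : ∀ (f : (UnitaryGroup.cmDatum L 3 H').Local v → ℂ) (π : IrrClass ((UnitaryGroup.cmDatum L 3 H').Local v)) (m n : ℤ),
      ((m + n : ℤ) : ℂ) * π.smoothTrace νG f = (m : ℂ) * π.smoothTrace νG f + (n : ℂ) * π.smoothTrace νG f := fun f π m n => by
    push_cast; ring
  -- the T4 telescope and print's virtual identity at it
  obtain ⟨O, χ, hχ, χ₁, χ₂, hq, hO, hρO⟩ := hL
  obtain ⟨ε, W, _, _, I, hIadm, hIfl, hI⟩ := hINDv O χ hχ χ₁ χ₂ hq hO hρO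
  -- JH-expansion of the admissible finite-length `I`
  obtain ⟨n, r, -, -, hsum⟩ := exists_smoothIrrep_isConstituentOf_smoothTrace_eq_sum hIadm hIfl
  refine ⟨∑ i, Finsupp.single (IrrClass.mk (r i)) ε, fun fH f hfH hf hΔ => ?_⟩
  have hsingle : ∀ i, (Finsupp.single (IrrClass.mk (r i)) ε).sum (fun π n => (n : ℂ) * π.smoothTrace νG f) =
      (ε : ℂ) * (IrrClass.mk (r i)).smoothTrace νG f := fun i => Finsupp.sum_single_index (h0 f _)
  change _ = (∑ i, Finsupp.single (IrrClass.mk (r i)) ε).sum (fun π n => (n : ℂ) * π.smoothTrace νG f)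
  rw [← Finsupp.sum_finsetSum_index (h0 f) (hadd f), Finset.sum_congr rfl fun i _ => hsingle i, ← Finset.mul_sum, ← hsum νG f]
  exact hI fH f hfH hf hΔ

end Summit.HodgeConjecture.HodgeConjecture.R90.S3

end
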